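import Summits.Ventures.HodgeKum4.Bookkeeping
import Literature.AlgebraicTopology.SingularHomology.CohomologyOfPoint
import HarnessLib

/-!
# Erratum to `Bookkeeping` L75 — `¬ PolarizationHasDualLefschetz`: the unguarded support S1 is false at `n = 0`
(cell `hodge-kum4`, seat p2; director-hodge rulings 2026-08-25T21:56:58Z (3) and 22:07:41Z: negative knowledge
made explicit in an erratum module; REF-AUDIT-8 §2, REF-AUDIT-9 §9 (2))

REPAIRED STATEMENT (what the printed theorem says): add the guards `1 ≤ n` and
`Motives.IsSmoothProjective n X` — for a smooth projective `X` of dimension `n ≥ 1` and a polarisation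
class `η`, `(L_η, h, Λ)` is an `sl₂`-triple for some `Λ` (Jacobson–Morozov on hard Lefschetz).  The
witness below (`n = 0`) misses the repaired statement.  NO replacement `def` is introduced here (an
unconsumed `Prop` definition under `Summits/` would be new debt): the consumable guarded form already
in the tree is André's printed fact `HodgeTheory.Andre1996_dualLefschetz_mem_adjoin_lefschetzInvolution`,
which is what the route's L3° branch uses (`KummerFixedLocusInvolutionParity`).  STANDING RULE of the
cell (director 21:56:58Z (2)): no theorem, stub or `--supports` file takes `PolarizationHasDualLefschetz`
as a hypothesis.

`Summit.Ventures.HodgeKum4.PolarizationHasDualLefschetz` (module `Summits/Ventures/HodgeKum4/Bookkeeping`,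
L75) reads `∀ ⦃n⦄ ⦃X⦄ (η : complexBetti X 2), IsPolarizationClass n X η → HasDualLefschetz n η` WITHOUT
the guards `1 ≤ n` / `IsSmoothProjective n X` that the printed statement carries (Jacobson–Morozov /
Lefschetz decomposition: Looijenga–Lunts 1997 §1, Voisin I Prop. 6.23–6.25).  WITNESS: `n = 0`,
`X = 𝟙_ = Spec ℂ` (one complex point), `η = 0`.  Then `IsPolarizationClass 0 X 0` holds (`0` is
rational, `0 ∈ N¹`, and hard Lefschetz in dimension `0` only asks `L⁰ = id : H⁰ ≃ H⁰`), while an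
`sl(2)`-partner `Λ` of `η` would need the degree operator `h = Σₖ (k − 0)·pr_k` to be non-zero
(`IsSl2Triple.h_ne_zero`, through `Hyperkaehler.isDualLefschetz_iff`) — but `H*(pt; ℂ) = H⁰`, on which
`h = 0`.  Everything is PROVED from the tree (`isZero_singularCohomology_of_subsingleton'`, Hatcher
§3.1 p. 199).  The route never consumed S1 (REF-AUDIT-8 §2: blast radius nil); the consumable guarded
form is André's printed fact `HodgeTheory.Andre1996_dualLefschetz_mem_adjoin_lefschetzInvolution`.
-/

noncomputable section

open CategoryTheory MonoidalCategory DirectSum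
open Literature.AlgebraicTopology.SingularHomology
open Literature.AlgebraicGeometry Literature.AlgebraicGeometry.HodgeTheory
open Literature.AlgebraicGeometry.Hyperkaehler (totalCohomology ofDegree degreeOperator degreeOperator_lof
  isDualLefschetz_iff)

attribute [local instance 100] LieRing.ofAssociativeRing

namespace Summit.Ventures.HodgeKum4

/-- The terminal `ℂ`-scheme `Spec ℂ` has exactly one complex point (morphisms into the monoidal unit of
a cartesian monoidal category are unique). -/
theorem subsingleton_complexPoints_tensorUnit :
    Subsingleton (Motives.ComplexPoints (𝟙_ (Motives.SchemeOver ℂ))) :=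
  ⟨fun a b => CartesianMonoidalCategory.toUnit_unique a b⟩

/-- On the one-point space `(Spec ℂ)(ℂ)` the degree operator for "dimension `0`" vanishes:
`h = Σₖ k·pr_k` and `Hᵏ(pt; ℂ) = 0` for `k ≥ 1`. -/
theorem degreeOperator_tensorUnit_eq_zero :
    degreeOperator ℂ (Motives.ComplexPoints (𝟙_ (Motives.SchemeOver ℂ))) 0 = 0 := by
  haveI := subsingleton_complexPoints_tensorUnit
  refine DirectSum.linearMap_ext ℂ fun k => LinearMap.ext fun x => ?_
  rw [LinearMap.comp_apply, LinearMap.comp_apply, LinearMap.zero_apply]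
  change degreeOperator ℂ _ 0 (ofDegree ℂ _ k x) = 0
  rw [degreeOperator_lof]
  rcases Nat.eq_zero_or_pos k with rfl | hk
  · simp
  · haveI := ModuleCat.subsingleton_of_isZero
      (singularCochainComplex.isZero_singularCohomology_of_subsingleton' (R := ℂ) (M := ℂ)
        (X := Motives.ComplexPoints (𝟙_ (Motives.SchemeOver ℂ))) (Nat.pos_iff_ne_zero.1 hk))
    rw [Subsingleton.elim x 0, map_zero, smul_zero]

/-- `η = 0` is a "polarisation class in dimension `0`" on `Spec ℂ` in the sense of
`HodgeTheory.IsPolarizationClass` (rational, in `N¹`, and `L⁰ = id` is bijective). -/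
theorem isPolarizationClass_zero_tensorUnit :
    IsPolarizationClass 0 (𝟙_ (Motives.SchemeOver ℂ)) (0 : complexBetti (𝟙_ (Motives.SchemeOver ℂ)) 2) where
  isRationalClass := IsRationalClass.zero
  mem_algebraicClasses := Submodule.zero_mem _
  hasHardLefschetz := by
    intro j k hjk
    obtain ⟨rfl, rfl⟩ : j = 0 ∧ k = 0 := by omega
    rw [Literature.Geometry.Kaehler.lefschetzPow_zero]
    exact Function.bijective_id

/-- **The unguarded S1 is false**: `¬ PolarizationHasDualLefschetz` (witness `n = 0`, `X = Spec ℂ`,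
`η = 0`; director-hodge ruling 2026-08-25T21:56:58Z, REF-AUDIT-8 §2).  Use André's printed, guarded
fact `HodgeTheory.Andre1996_dualLefschetz_mem_adjoin_lefschetzInvolution` instead. -/
theorem not_polarizationHasDualLefschetz : ¬ Summit.Ventures.HodgeKum4.PolarizationHasDualLefschetz := by
  intro h
  obtain ⟨Λ, hΛ⟩ := h (0 : complexBetti (𝟙_ (Motives.SchemeOver ℂ)) 2) isPolarizationClass_zero_tensorUnit
  exact ((isDualLefschetz_iff (R := ℂ) 0 _ Λ).1 hΛ).1 degreeOperator_tensorUnit_eq_zero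

end Summit.Ventures.HodgeKum4

end
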